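import Summits.SmoothPoincare4.SmoothPoincare4.Theorems.ConvexBisectionAcyclicBisectionExistsCrossingNumberOrientation
import HarnessLib

/-!
# Annulus charts of node N1a are immersions: the calculus entry points of the symmetry step
(wave 3, brick Z6-9 — for the symmetry step (R1) of the missing lemma `crossingNumber_eq_stdSymp`
of node N1a `node_M3c_shadow_pageDehnTwist` (Picard–Lefschetz on shadows) of stub
`stub_modelsOnFibred_of_reach` = NF4, line `modp-braid-orbits`, crux
`ConvexBisection.AcyclicBisectionExists`, item stmt-SmoothPoincare4-10508; registered sub-goal
`helper_chart_immersion`)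

The chart hypotheses of node N1a are manifold-valued (`ContMDiff 𝓘(ℝ, ℝ × ℝ) (𝓡∂ 4) ∞ φ` into
`Base g`) and the orientation hypothesis `hφo` is phrased with one-variable `deriv`s of the
ambient partial maps.  This file translates them into the plain calculus of the ambient map
`Φ p = (φ p).1 : ℝ × ℝ → ℝ⁴` that the transition-map / implicit-function arguments of the symmetry
step consume:

* §1 `contDiff_val_of_chart` — `Φ` is `C^∞` (smoothness of the inclusion `Base g ↪ ℝ⁴`,
  `RegularSublevel.contMDiff_incl`, and `contMDiff_iff_contDiff`); `continuous_fderiv_val`;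
* §2 `hasDerivAt_val_u`, `hasDerivAt_val_r`, `deriv_val_u`, `deriv_val_r` — the `deriv`s of `hφo`
  are the partial derivatives `dΦ (1, 0)`, `dΦ (0, 1)`; `orient_fderiv` — `hφo` in that form;
* §3 `ne_zero_of_inner_cplxJ_pos`, `linearIndependent_of_inner_cplxJ_pos` — a pair `(v, w)` with
  `0 < ⟪w, i v⟫` is linearly independent; **`injective_fderiv_of_chart`** /
  `helper_chart_immersion` — on the open strip `ℝ × (−1, 1)` the chart is an IMMERSION
  (`dΦ` injective), the input of the inverse function theorem for the transition maps.

Everything is proved; no definitions, no named facts, no `sorry`.  References: J. M. Lee,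
*Introduction to Smooth Manifolds* (2012), Prop. 5.22 / Thm. 4.25 (immersions, local embeddings)
[LeeSmoothManifolds2013]; B. Farb, D. Margalit, *A primer on mapping class groups* (2012), §6.1
[FarbMargalit2012].
-/

noncomputable section

set_option linter.dupNamespace false

open scoped Manifold ContDiff Topology
open Set Function
open Literature.Topology.FourManifolds Literature.Topology.FourManifolds.LefschetzBase

namespace Summit.SmoothPoincare4.SmoothPoincare4.Theorems.AcyclicBisectionExists.ModpBraidOrbits

variable {g : ℕ} {φ : ℝ × ℝ → Base g}

/-! ## §1 The ambient chart map is smooth -/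

/-- **The ambient map `p ↦ (φ p).1 : ℝ × ℝ → ℝ⁴` of a smooth chart into the base is `C^∞`.**
[cite: LeeSmoothManifolds2013, Prop. 5.22] -/
theorem contDiff_val_of_chart (hφs : ContMDiff 𝓘(ℝ, ℝ × ℝ) (𝓡∂ 4) ∞ φ) :
    ContDiff ℝ ∞ (fun p : ℝ × ℝ => (φ p).1) := by
  have h := (RegularSublevel.contMDiff_incl (isRegularLevel_rho g)).comp hφs
  rw [contMDiff_iff_contDiff] at h
  exact h

/-- The differential of the ambient chart map is continuous. [folklore] -/
theorem continuous_fderiv_val (hφs : ContMDiff 𝓘(ℝ, ℝ × ℝ) (𝓡∂ 4) ∞ φ) :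
    Continuous fun p : ℝ × ℝ => fderiv ℝ (fun p : ℝ × ℝ => (φ p).1) p :=
  (contDiff_val_of_chart hφs).continuous_fderiv (by simp)

/-- The ambient chart map is differentiable. [folklore] -/
theorem hasFDerivAt_val (hφs : ContMDiff 𝓘(ℝ, ℝ × ℝ) (𝓡∂ 4) ∞ φ) (p : ℝ × ℝ) :
    HasFDerivAt (fun p : ℝ × ℝ => (φ p).1) (fderiv ℝ (fun p : ℝ × ℝ => (φ p).1) p) p :=
  ((contDiff_val_of_chart hφs).differentiable (by simp)).differentiableAt.hasFDerivAt

/-! ## §2 The partial derivatives -/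

/-- **`∂ᵤ` of the ambient chart map is `dΦ (1, 0)`.** [folklore] -/
theorem hasDerivAt_val_u (hφs : ContMDiff 𝓘(ℝ, ℝ × ℝ) (𝓡∂ 4) ∞ φ) (u r : ℝ) :
    HasDerivAt (fun u' => (φ (u', r)).1)
      (fderiv ℝ (fun p : ℝ × ℝ => (φ p).1) (u, r) ((1 : ℝ), (0 : ℝ))) u := by
  have h2 : HasDerivAt (fun u' : ℝ => ((u', r) : ℝ × ℝ)) ((1 : ℝ), (0 : ℝ)) u :=
    (hasDerivAt_id' u).prodMk (hasDerivAt_const u r)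
  exact (hasFDerivAt_val hφs (u, r)).comp_hasDerivAt u h2

/-- **`∂ᵣ` of the ambient chart map is `dΦ (0, 1)`.** [folklore] -/
theorem hasDerivAt_val_r (hφs : ContMDiff 𝓘(ℝ, ℝ × ℝ) (𝓡∂ 4) ∞ φ) (u r : ℝ) :
    HasDerivAt (fun r' => (φ (u, r')).1)
      (fderiv ℝ (fun p : ℝ × ℝ => (φ p).1) (u, r) ((0 : ℝ), (1 : ℝ))) r := by
  have h2 : HasDerivAt (fun r' : ℝ => ((u, r') : ℝ × ℝ)) ((0 : ℝ), (1 : ℝ)) r :=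
    (hasDerivAt_const r u).prodMk (hasDerivAt_id' r)
  exact (hasFDerivAt_val hφs (u, r)).comp_hasDerivAt r h2

/-- `deriv` form of `hasDerivAt_val_u`. [folklore] -/
theorem deriv_val_u (hφs : ContMDiff 𝓘(ℝ, ℝ × ℝ) (𝓡∂ 4) ∞ φ) (u r : ℝ) :
    deriv (fun u' => (φ (u', r)).1) u = fderiv ℝ (fun p : ℝ × ℝ => (φ p).1) (u, r) ((1 : ℝ), (0 : ℝ)) :=
  (hasDerivAt_val_u hφs u r).deriv

/-- `deriv` form of `hasDerivAt_val_r`. [folklore] -/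
theorem deriv_val_r (hφs : ContMDiff 𝓘(ℝ, ℝ × ℝ) (𝓡∂ 4) ∞ φ) (u r : ℝ) :
    deriv (fun r' => (φ (u, r')).1) r = fderiv ℝ (fun p : ℝ × ℝ => (φ p).1) (u, r) ((0 : ℝ), (1 : ℝ)) :=
  (hasDerivAt_val_r hφs u r).deriv

/-- **The orientation hypothesis of node N1a in terms of `dΦ`**: `0 < ⟪dΦ (0, 1), i dΦ (1, 0)⟫` on
the open strip. [folklore] -/
theorem orient_fderiv (hφs : ContMDiff 𝓘(ℝ, ℝ × ℝ) (𝓡∂ 4) ∞ φ)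
    (hφo : ∀ u r, r ∈ Ioo (-1 : ℝ) 1 →
      0 < inner ℝ (deriv (fun r' => (φ (u, r')).1) r) (cplxJ (deriv (fun u' => (φ (u', r)).1) u)))
    {u r : ℝ} (hr : r ∈ Ioo (-1 : ℝ) 1) :
    0 < inner ℝ (fderiv ℝ (fun p : ℝ × ℝ => (φ p).1) (u, r) ((0 : ℝ), (1 : ℝ)))
      (cplxJ (fderiv ℝ (fun p : ℝ × ℝ => (φ p).1) (u, r) ((1 : ℝ), (0 : ℝ)))) := by
  have h := hφo u r hr
  rwa [deriv_val_u hφs, deriv_val_r hφs] at h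

/-! ## §3 Positively paired vectors are independent: the chart is an immersion -/

/-- `i 0 = 0`. [folklore] -/
theorem cplxJ_zero : cplxJ (0 : EuclideanSpace ℝ (Fin 4)) = 0 := by
  have h := cplxJ_smul 0 (0 : EuclideanSpace ℝ (Fin 4))
  rwa [zero_smul, zero_smul] at h

/-- A positively paired pair has non-zero members. [folklore] -/
theorem ne_zero_of_inner_cplxJ_pos {v w : EuclideanSpace ℝ (Fin 4)} (h : 0 < inner ℝ w (cplxJ v)) :
    v ≠ 0 ∧ w ≠ 0 := by
  constructor
  · rintro rfl
    rw [cplxJ_zero, inner_zero_right] at h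
    exact lt_irrefl _ h
  · rintro rfl
    rw [inner_zero_left] at h
    exact lt_irrefl _ h

/-- **A positively paired pair `(v, w)` (`0 < ⟪w, i v⟫`) is linearly independent**: from
`a v + b w = 0`, pairing with `i v` kills `a` (`⟪v, i v⟫ = 0`) and gives `b = 0`, then `a = 0`.
[folklore] -/
theorem eq_zero_of_inner_cplxJ_pos {v w : EuclideanSpace ℝ (Fin 4)} (h : 0 < inner ℝ w (cplxJ v))
    {a b : ℝ} (hab : a • v + b • w = 0) : a = 0 ∧ b = 0 := by
  have hb : b = 0 := by
    have e := congrArg (fun x => inner ℝ x (cplxJ v)) hab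
    simp only [inner_zero_left] at e
    rw [inner_add_smul_cplxJ] at e
    rcases mul_eq_zero.1 e with hb | hv
    · exact hb
    · exact absurd hv h.ne'
  subst hb
  rw [zero_smul, add_zero] at hab
  rcases smul_eq_zero.1 hab with ha | hv
  · exact ⟨ha, rfl⟩
  · exact absurd hv (ne_zero_of_inner_cplxJ_pos h).1

/-- **An annulus chart of node N1a is an immersion on the open strip**: its ambient differential
`dΦ_{(u, r)} : ℝ² → ℝ⁴` is injective for `r ∈ (−1, 1)`. [cite: LeeSmoothManifolds2013, Prop. 5.22] -/
theorem injective_fderiv_of_chart (hφs : ContMDiff 𝓘(ℝ, ℝ × ℝ) (𝓡∂ 4) ∞ φ)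
    (hφo : ∀ u r, r ∈ Ioo (-1 : ℝ) 1 →
      0 < inner ℝ (deriv (fun r' => (φ (u, r')).1) r) (cplxJ (deriv (fun u' => (φ (u', r)).1) u)))
    {u r : ℝ} (hr : r ∈ Ioo (-1 : ℝ) 1) :
    Injective (fderiv ℝ (fun p : ℝ × ℝ => (φ p).1) (u, r)) := by
  set L := fderiv ℝ (fun p : ℝ × ℝ => (φ p).1) (u, r) with hL
  have hpos := orient_fderiv hφs hφo (u := u) hr
  rw [← hL] at hpos
  refine (injective_iff_map_eq_zero L).2 fun q hq => ?_
  have e : q = q.1 • ((1 : ℝ), (0 : ℝ)) + q.2 • ((0 : ℝ), (1 : ℝ)) := by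
    ext <;> simp
  rw [e, map_add, map_smul, map_smul] at hq
  obtain ⟨h1, h2⟩ := eq_zero_of_inner_cplxJ_pos hpos hq
  exact Prod.ext h1 h2

/-! ## §4 The registered form -/

/-- **Sub-goal `helper_chart_immersion`** (Z6-9, calculus entry point of the symmetry step (R1) of
the missing lemma of node N1a of NF4): a chart `φ : ℝ × ℝ → Base g` which is smooth into the base
and satisfies the orientation hypothesis of node N1a has ambient map `p ↦ (φ p).1` of class `C^∞`
with INJECTIVE differential at every point of the open strip `ℝ × (−1, 1)` (an immersion).
[cite: LeeSmoothManifolds2013, Prop. 5.22] -/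
theorem helper_chart_immersion : ∀ (g : ℕ) (φ : ℝ × ℝ → Literature.Topology.FourManifolds.LefschetzBase.Base g), ContMDiff 𝓘(ℝ, ℝ × ℝ) (𝓡∂ 4) ∞ φ → (∀ u r, r ∈ Set.Ioo (-1 : ℝ) 1 → 0 < inner ℝ (deriv (fun r' => (φ (u, r')).1) r) (Literature.Topology.FourManifolds.LefschetzBase.cplxJ (deriv (fun u' => (φ (u', r)).1) u))) → ContDiff ℝ ∞ (fun p : ℝ × ℝ => (φ p).1) ∧ ∀ u r, r ∈ Set.Ioo (-1 : ℝ) 1 → Function.Injective (fderiv ℝ (fun p : ℝ × ℝ => (φ p).1) (u, r)) :=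
  fun _ _ hφs hφo => ⟨contDiff_val_of_chart hφs, fun _ _ hr => injective_fderiv_of_chart hφs hφo hr⟩

end Summit.SmoothPoincare4.SmoothPoincare4.Theorems.AcyclicBisectionExists.ModpBraidOrbits

end
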